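import Summits.AtomisticToContinuum.FouriersLaw.Theorems.OddSectorIrreversibilityOddCorrectorDecayPointwiseWeights
import Literature.MathematicalPhysics.KineticTheory.LangevinChainKernel

/-!
# Pointwise inequalities for the bath-locality estimate, II: the boundary forcing

Support file for item `stmt-AtomisticToContinuum-9139` (`OddSectorIrreversibility.OddCorrectorDecay`), negative
side. The forcing factor of the pathwise bound `ChainVariation.sq_totalCurrent_sub_le_path` is
`G_t = F(t) + ∫₀ᵗ F`, `F(u) = ∑_i |η_i(u) - γ ∫₀ᵘ w_i p_i(z)|`, where for the Brownian-driven open chain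
`z = Φ(x, B(ω))` (`OscillatorChain.solMap`, both baths at `T`, amplitude `c = √(2γT)`) the noise is
`η_i(u) = [i=0] c B¹_u + [i=N-1] c B²_u` (`chainNoise_pairPath`) and `w_i = [i=0] + [i=N-1]` (`bathWeight`). Only
the two boundary momenta enter, so `G_t⁶` is bounded by BATH-SIZE quantities (no factor `N`):
* `forcing_le` — `F(u) ≤ |c|(|B¹_u| + |B²_u|) + γ ∫₀ᵘ (|p_0(z_v)| + |p_{N-1}(z_v)|) dv`;
* `forcing_pow_six_le` — `F(u)⁶ ≤ 1024 (c⁶|B¹_u|⁶ + c⁶|B²_u|⁶ + 32 γ⁶ t₀⁵ ∫₀ᵗ (p_0(z_v)⁶ + p_{N-1}(z_v)⁶) dv)`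
  for `0 ≤ u ≤ t ≤ t₀` (Jensen `(∫₀ᵘ g)⁶ ≤ u⁵ ∫₀ᵘ g⁶`);
* `forcingTotal_pow_six_le` — **`G_t⁶ ≤ a₁ (|B¹_t|⁶ + |B²_t|⁶) + a₂ ∫₀ᵗ (|B¹_u|⁶ + |B²_u|⁶) du
  + a₃ ∫₀ᵗ (p_0(z_v)⁶ + p_{N-1}(z_v)⁶) dv`** with `a₁ = 32768 c⁶`, `a₂ = 32768 t₀⁵ c⁶`,
  `a₃ = 1048576 γ⁶ t₀⁵ (1 + t₀⁶)`, for `0 < t ≤ t₀`.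
-/

noncomputable section

open MeasureTheory Set Finset intervalIntegral
open scoped NNReal
open Literature.Probability.Process
open Literature.MathematicalPhysics.KineticTheory Literature.MathematicalPhysics.KineticTheory.HeatConduction
open OscillatorChain (bathWeight)

namespace Summit.AtomisticToContinuum.FouriersLaw.Theorems.ChainVariation

variable {N : ℕ}

/-- A sum over the sites of a Kronecker delta at level `m < N` picks the value at `⟨m, _⟩`. [folklore] -/
theorem sum_ite_val_eq {m : ℕ} (hm : m < N) (g : Fin N → ℝ) :
    (∑ i : Fin N, if i.val = m then g i else 0) = g ⟨m, hm⟩ := by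
  rw [Finset.sum_eq_single_of_mem (⟨m, hm⟩ : Fin N) (Finset.mem_univ _)]
  · simp
  · intro j _ hj
    rw [if_neg]
    intro e
    exact hj (Fin.ext e)

section Forcing

variable {ω₂ lam β γ : ℝ} (hω : 0 < ω₂) (hl : 0 ≤ lam) (hβ : 0 ≤ β) (hγ : 0 ≤ γ) (hN : 0 < N) (T : ℝ)
include hω hl hβ hγ hN

omit hN in
/-- Continuity in time of a momentum of the Brownian-driven open chain. [folklore] -/
theorem continuous_momentum_openChain (x : PhaseSpace N) (ω : WienerPair) (i : Fin N) :
    Continuous fun v => ((pinnedChain ω₂ lam β γ).chainFlow N x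
      (chainNoise N (Real.sqrt (2 * (pinnedChain ω₂ lam β γ).γ * T))
        (Real.sqrt (2 * (pinnedChain ω₂ lam β γ).γ * T)) (pairPath ω)) v).2 i :=
  (continuous_apply i).comp (continuous_snd.comp
    (pinnedChain_continuous_chainFlow hω hl hβ hγ N x (continuous_chainNoise _ _ _)))

omit hN in
/-- Continuity in time of the forcing `F(u) = ∑_i |η_i(u) - γ ∫₀ᵘ w_i p_i(z)|`. [folklore] -/
theorem continuous_forcing (x : PhaseSpace N) (ω : WienerPair) :
    Continuous fun u => ∑ i : Fin N, |chainNoise N (Real.sqrt (2 * (pinnedChain ω₂ lam β γ).γ * T))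
        (Real.sqrt (2 * (pinnedChain ω₂ lam β γ).γ * T)) (pairPath ω) u i -
      γ * ∫ v in (0:ℝ)..u, bathWeight N i * ((pinnedChain ω₂ lam β γ).chainFlow N x
        (chainNoise N (Real.sqrt (2 * (pinnedChain ω₂ lam β γ).γ * T))
          (Real.sqrt (2 * (pinnedChain ω₂ lam β γ).γ * T)) (pairPath ω)) v).2 i| := by
  refine continuous_finsetSum _ fun i _ => ?_
  refine ((continuous_apply i).comp (continuous_chainNoise _ _ _)).sub (continuous_const.mul ?_) |>.abs
  have hc : Continuous fun v => bathWeight N i * ((pinnedChain ω₂ lam β γ).chainFlow N x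
      (chainNoise N (Real.sqrt (2 * (pinnedChain ω₂ lam β γ).γ * T))
        (Real.sqrt (2 * (pinnedChain ω₂ lam β γ).γ * T)) (pairPath ω)) v).2 i :=
    continuous_const.mul (continuous_momentum_openChain hω hl hβ hγ T x ω i)
  exact continuous_primitive (fun a b => hc.intervalIntegrable a b) 0

/-- **The forcing only sees the two bath momenta and the two Brownian motions**:
`F(u) ≤ |c|(|B¹_u| + |B²_u|) + γ ∫₀ᵘ (|p_0(z_v)| + |p_{N-1}(z_v)|) dv` for `u ≥ 0`. [folklore] -/
theorem forcing_le (x : PhaseSpace N) (ω : WienerPair) {u : ℝ} (hu : 0 ≤ u) :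
    (∑ i : Fin N, |chainNoise N (Real.sqrt (2 * (pinnedChain ω₂ lam β γ).γ * T))
        (Real.sqrt (2 * (pinnedChain ω₂ lam β γ).γ * T)) (pairPath ω) u i -
      γ * ∫ v in (0:ℝ)..u, bathWeight N i * ((pinnedChain ω₂ lam β γ).chainFlow N x
        (chainNoise N (Real.sqrt (2 * (pinnedChain ω₂ lam β γ).γ * T))
          (Real.sqrt (2 * (pinnedChain ω₂ lam β γ).γ * T)) (pairPath ω)) v).2 i|) ≤
      |Real.sqrt (2 * (pinnedChain ω₂ lam β γ).γ * T)| * |brownian u.toNNReal ω.1| +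
        |Real.sqrt (2 * (pinnedChain ω₂ lam β γ).γ * T)| * |brownian u.toNNReal ω.2| +
        γ * ∫ v in (0:ℝ)..u, (|((pinnedChain ω₂ lam β γ).chainFlow N x
            (chainNoise N (Real.sqrt (2 * (pinnedChain ω₂ lam β γ).γ * T))
              (Real.sqrt (2 * (pinnedChain ω₂ lam β γ).γ * T)) (pairPath ω)) v).2 ⟨0, hN⟩| +
          |((pinnedChain ω₂ lam β γ).chainFlow N x
            (chainNoise N (Real.sqrt (2 * (pinnedChain ω₂ lam β γ).γ * T))
              (Real.sqrt (2 * (pinnedChain ω₂ lam β γ).γ * T)) (pairPath ω)) v).2 ⟨N - 1, by omega⟩|) := by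
  set P := pinnedChain ω₂ lam β γ with hP
  set c := Real.sqrt (2 * P.γ * T) with hc
  set η := chainNoise N c c (pairPath ω) with hη
  set z : ℝ → PhaseSpace N := P.chainFlow N x η with hz
  have hzc : ∀ i, Continuous fun v => (z v).2 i := fun i => continuous_momentum_openChain hω hl hβ hγ T x ω i
  -- termwise
  have hterm : ∀ i : Fin N, |η u i - γ * ∫ v in (0:ℝ)..u, bathWeight N i * (z v).2 i| ≤
      ((if i.val = 0 then |c| * |(brownian u.toNNReal ω.1)| else 0) + (if i.val = N - 1 then |c| * |(brownian u.toNNReal ω.2)| else 0)) +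
        γ * ∫ v in (0:ℝ)..u, bathWeight N i * |(z v).2 i| := by
    intro i
    have h1 : |η u i| ≤ (if i.val = 0 then |c| * |(brownian u.toNNReal ω.1)| else 0) + (if i.val = N - 1 then |c| * |(brownian u.toNNReal ω.2)| else 0) := by
      rw [hη, chainNoise_pairPath]
      refine (abs_add_le _ _).trans (add_le_add ?_ ?_)
      · split_ifs <;> simp [abs_mul]
      · split_ifs <;> simp [abs_mul]
    have h2 : |γ * ∫ v in (0:ℝ)..u, bathWeight N i * (z v).2 i| ≤ γ * ∫ v in (0:ℝ)..u, bathWeight N i * |(z v).2 i| := by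
      rw [abs_mul, abs_of_nonneg hγ]
      refine mul_le_mul_of_nonneg_left ?_ hγ
      refine (abs_integral_le_integral_abs hu).trans (le_of_eq ?_)
      have hw0 : 0 ≤ bathWeight N i := by unfold bathWeight; split_ifs <;> norm_num
      refine intervalIntegral.integral_congr fun v _ => ?_
      simp only [abs_mul, abs_of_nonneg hw0]
    calc |η u i - γ * ∫ v in (0:ℝ)..u, bathWeight N i * (z v).2 i|
        ≤ |η u i| + |γ * ∫ v in (0:ℝ)..u, bathWeight N i * (z v).2 i| := abs_sub _ _
      _ ≤ _ := add_le_add h1 h2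
  -- sum
  have hsum1 : ∑ i : Fin N, ((if i.val = 0 then |c| * |(brownian u.toNNReal ω.1)| else 0) + (if i.val = N - 1 then |c| * |(brownian u.toNNReal ω.2)| else 0)) =
      |c| * |(brownian u.toNNReal ω.1)| + |c| * |(brownian u.toNNReal ω.2)| := by
    rw [Finset.sum_add_distrib, sum_ite_val_eq hN (fun _ => |c| * |(brownian u.toNNReal ω.1)|),
      sum_ite_val_eq (by omega : N - 1 < N) (fun _ => |c| * |(brownian u.toNNReal ω.2)|)]
  have hint : ∀ i : Fin N, IntervalIntegrable (fun v => bathWeight N i * |(z v).2 i|) volume 0 u := fun i =>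
    (continuous_const.mul (hzc i).abs).intervalIntegrable _ _
  have hsum2 : ∑ i : Fin N, γ * ∫ v in (0:ℝ)..u, bathWeight N i * |(z v).2 i| =
      γ * ∫ v in (0:ℝ)..u, (|(z v).2 ⟨0, hN⟩| + |(z v).2 ⟨N - 1, by omega⟩|) := by
    rw [← Finset.mul_sum, ← intervalIntegral.integral_finsetSum fun i _ => hint i]
    congr 1
    refine intervalIntegral.integral_congr fun v _ => ?_
    simp only [bathWeight, add_mul, Finset.sum_add_distrib, ite_mul, one_mul, zero_mul]
    rw [sum_ite_val_eq hN (fun i => |(z v).2 i|), sum_ite_val_eq (by omega : N - 1 < N) (fun i => |(z v).2 i|)]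
  calc ∑ i : Fin N, |η u i - γ * ∫ v in (0:ℝ)..u, bathWeight N i * (z v).2 i|
      ≤ ∑ i : Fin N, (((if i.val = 0 then |c| * |(brownian u.toNNReal ω.1)| else 0) + (if i.val = N - 1 then |c| * |(brownian u.toNNReal ω.2)| else 0)) +
          γ * ∫ v in (0:ℝ)..u, bathWeight N i * |(z v).2 i|) := Finset.sum_le_sum fun i _ => hterm i
    _ = |c| * |(brownian u.toNNReal ω.1)| + |c| * |(brownian u.toNNReal ω.2)| + γ * ∫ v in (0:ℝ)..u, (|(z v).2 ⟨0, hN⟩| + |(z v).2 ⟨N - 1, by omega⟩|) := by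
        rw [Finset.sum_add_distrib, hsum1, hsum2]

/-- **Sixth power of the forcing**: for `0 ≤ u ≤ t ≤ t₀`,
`F(u)⁶ ≤ 1024 (c⁶|B¹_u|⁶ + c⁶|B²_u|⁶ + 32 γ⁶ t₀⁵ ∫₀ᵗ (p_0(z_v)⁶ + p_{N-1}(z_v)⁶) dv)`. [folklore] -/
theorem forcing_pow_six_le (x : PhaseSpace N) (ω : WienerPair) {u t t₀ : ℝ} (hu : 0 ≤ u) (hut : u ≤ t)
    (htt : t ≤ t₀) :
    (∑ i : Fin N, |chainNoise N (Real.sqrt (2 * (pinnedChain ω₂ lam β γ).γ * T))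
        (Real.sqrt (2 * (pinnedChain ω₂ lam β γ).γ * T)) (pairPath ω) u i -
      γ * ∫ v in (0:ℝ)..u, bathWeight N i * ((pinnedChain ω₂ lam β γ).chainFlow N x
        (chainNoise N (Real.sqrt (2 * (pinnedChain ω₂ lam β γ).γ * T))
          (Real.sqrt (2 * (pinnedChain ω₂ lam β γ).γ * T)) (pairPath ω)) v).2 i|) ^ 6 ≤
      1024 * ((Real.sqrt (2 * (pinnedChain ω₂ lam β γ).γ * T)) ^ 6 * |brownian u.toNNReal ω.1| ^ 6 +
        (Real.sqrt (2 * (pinnedChain ω₂ lam β γ).γ * T)) ^ 6 * |brownian u.toNNReal ω.2| ^ 6 +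
        32 * γ ^ 6 * t₀ ^ 5 * ∫ v in (0:ℝ)..t, (((pinnedChain ω₂ lam β γ).chainFlow N x
            (chainNoise N (Real.sqrt (2 * (pinnedChain ω₂ lam β γ).γ * T))
              (Real.sqrt (2 * (pinnedChain ω₂ lam β γ).γ * T)) (pairPath ω)) v).2 ⟨0, hN⟩ ^ 6 +
          ((pinnedChain ω₂ lam β γ).chainFlow N x
            (chainNoise N (Real.sqrt (2 * (pinnedChain ω₂ lam β γ).γ * T))
              (Real.sqrt (2 * (pinnedChain ω₂ lam β γ).γ * T)) (pairPath ω)) v).2 ⟨N - 1, by omega⟩ ^ 6)) := by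
  set P := pinnedChain ω₂ lam β γ with hP
  set c := Real.sqrt (2 * P.γ * T) with hc
  set η := chainNoise N c c (pairPath ω) with hη
  set z : ℝ → PhaseSpace N := P.chainFlow N x η with hz
  have hzc : ∀ i, Continuous fun v => (z v).2 i := fun i => continuous_momentum_openChain hω hl hβ hγ T x ω i
  set i₀ : Fin N := ⟨0, hN⟩
  set i₁ : Fin N := ⟨N - 1, by omega⟩
  set g : ℝ → ℝ := fun v => |(z v).2 i₀| + |(z v).2 i₁| with hg
  have hgc : Continuous g := (hzc i₀).abs.add (hzc i₁).abs
  have hg0 : ∀ v, 0 ≤ g v := fun v => by positivity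
  have hF0 : 0 ≤ ∑ i : Fin N, |η u i - γ * ∫ v in (0:ℝ)..u, bathWeight N i * (z v).2 i| :=
    Finset.sum_nonneg fun i _ => abs_nonneg _
  have hle := forcing_le hω hl hβ hγ hN T x ω hu
  set A := |c| * |brownian u.toNNReal ω.1| with hA
  set B := |c| * |brownian u.toNNReal ω.2| with hB
  set C := γ * ∫ v in (0:ℝ)..u, g v with hC
  have ht0 : 0 ≤ t := hu.trans hut
  -- the friction impulse
  have hC6 : C ^ 6 ≤ 32 * γ ^ 6 * t₀ ^ 5 * ∫ v in (0:ℝ)..t, ((z v).2 i₀ ^ 6 + (z v).2 i₁ ^ 6) := by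
    have hK0 : 0 ≤ ∫ v in (0:ℝ)..t, ((z v).2 i₀ ^ 6 + (z v).2 i₁ ^ 6) :=
      intervalIntegral.integral_nonneg ht0 fun v _ => by positivity
    have ht0' : 0 ≤ t₀ := ht0.trans htt
    rcases eq_or_lt_of_le hu with h0 | hpos
    · have : C = 0 := by rw [hC, ← h0, intervalIntegral.integral_same, mul_zero]
      rw [this, zero_pow (by norm_num)]
      exact mul_nonneg (mul_nonneg (by positivity) (pow_nonneg ht0' 5)) hK0
    have hJ := intervalIntegral_pow_six_le hgc hpos
    have hg6 : ∫ v in (0:ℝ)..u, g v ^ 6 ≤ 32 * ∫ v in (0:ℝ)..t, ((z v).2 i₀ ^ 6 + (z v).2 i₁ ^ 6) := by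
      have h1 : ∫ v in (0:ℝ)..u, g v ^ 6 ≤ ∫ v in (0:ℝ)..u, 32 * ((z v).2 i₀ ^ 6 + (z v).2 i₁ ^ 6) := by
        refine intervalIntegral.integral_mono_on hu ((hgc.pow 6).intervalIntegrable _ _)
          ((continuous_const.mul (((hzc i₀).pow 6).add ((hzc i₁).pow 6))).intervalIntegrable _ _) fun v _ => ?_
        have := add_pow_six_le |(z v).2 i₀| |(z v).2 i₁|
        simp only [pow_abs, abs_of_nonneg (by positivity : (0:ℝ) ≤ (z v).2 i₀ ^ 6)] at this
        simpa only [hg, pow_abs, abs_pow, abs_abs, Even.pow_abs (by decide : Even 6)] using this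
      have h2 : ∫ v in (0:ℝ)..u, 32 * ((z v).2 i₀ ^ 6 + (z v).2 i₁ ^ 6) ≤
          ∫ v in (0:ℝ)..t, 32 * ((z v).2 i₀ ^ 6 + (z v).2 i₁ ^ 6) :=
        intervalIntegral.integral_mono_interval le_rfl hu hut
          (Filter.Eventually.of_forall fun v => by positivity)
          ((continuous_const.mul (((hzc i₀).pow 6).add ((hzc i₁).pow 6))).intervalIntegrable _ _)
      simp only [intervalIntegral.integral_const_mul] at h1 h2 ⊢
      linarith [h1, h2]
    have hu5 : u ^ 5 ≤ t₀ ^ 5 := pow_le_pow_left₀ hu (hut.trans htt) 5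
    have hI0 : 0 ≤ ∫ v in (0:ℝ)..u, g v ^ 6 := intervalIntegral.integral_nonneg hu fun v _ => by positivity
    calc C ^ 6 = γ ^ 6 * (∫ v in (0:ℝ)..u, g v) ^ 6 := by rw [hC, mul_pow]
      _ ≤ γ ^ 6 * (u ^ 5 * ∫ v in (0:ℝ)..u, g v ^ 6) := mul_le_mul_of_nonneg_left hJ (by positivity)
      _ ≤ γ ^ 6 * (t₀ ^ 5 * (32 * ∫ v in (0:ℝ)..t, ((z v).2 i₀ ^ 6 + (z v).2 i₁ ^ 6))) :=
          mul_le_mul_of_nonneg_left (mul_le_mul hu5 hg6 hI0 (pow_nonneg ht0' 5)) (by positivity)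
      _ = _ := by ring
  have hA6 : A ^ 6 = c ^ 6 * |brownian u.toNNReal ω.1| ^ 6 := by
    rw [hA, mul_pow, Even.pow_abs (by decide : Even 6)]
  have hB6 : B ^ 6 = c ^ 6 * |brownian u.toNNReal ω.2| ^ 6 := by
    rw [hB, mul_pow, Even.pow_abs (by decide : Even 6)]
  calc (∑ i : Fin N, |η u i - γ * ∫ v in (0:ℝ)..u, bathWeight N i * (z v).2 i|) ^ 6
      ≤ (A + B + C) ^ 6 := pow_le_pow_left₀ hF0 hle 6
    _ ≤ 1024 * (A ^ 6 + B ^ 6 + C ^ 6) := add_add_pow_six_le A B C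
    _ ≤ _ := by rw [hA6, hB6]; nlinarith [hC6]

/-- **The total forcing factor**: for `0 < t ≤ t₀`,
`(F(t) + ∫₀ᵗ F)⁶ ≤ 32768 c⁶ (|B¹_t|⁶ + |B²_t|⁶) + 32768 t₀⁵ c⁶ ∫₀ᵗ (|B¹_u|⁶ + |B²_u|⁶) du
+ 1048576 γ⁶ t₀⁵ (1 + t₀⁶) ∫₀ᵗ (p_0(z_v)⁶ + p_{N-1}(z_v)⁶) dv`. [folklore] -/
theorem forcingTotal_pow_six_le (x : PhaseSpace N) (ω : WienerPair) {t t₀ : ℝ} (ht : 0 < t) (htt : t ≤ t₀) :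
    ((∑ i : Fin N, |chainNoise N (Real.sqrt (2 * (pinnedChain ω₂ lam β γ).γ * T))
        (Real.sqrt (2 * (pinnedChain ω₂ lam β γ).γ * T)) (pairPath ω) t i -
      γ * ∫ v in (0:ℝ)..t, bathWeight N i * ((pinnedChain ω₂ lam β γ).chainFlow N x
        (chainNoise N (Real.sqrt (2 * (pinnedChain ω₂ lam β γ).γ * T))
          (Real.sqrt (2 * (pinnedChain ω₂ lam β γ).γ * T)) (pairPath ω)) v).2 i|) +
      ∫ u in (0:ℝ)..t, ∑ i : Fin N, |chainNoise N (Real.sqrt (2 * (pinnedChain ω₂ lam β γ).γ * T))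
        (Real.sqrt (2 * (pinnedChain ω₂ lam β γ).γ * T)) (pairPath ω) u i -
      γ * ∫ v in (0:ℝ)..u, bathWeight N i * ((pinnedChain ω₂ lam β γ).chainFlow N x
        (chainNoise N (Real.sqrt (2 * (pinnedChain ω₂ lam β γ).γ * T))
          (Real.sqrt (2 * (pinnedChain ω₂ lam β γ).γ * T)) (pairPath ω)) v).2 i|) ^ 6 ≤
      32768 * (Real.sqrt (2 * (pinnedChain ω₂ lam β γ).γ * T)) ^ 6 *
          (|brownian t.toNNReal ω.1| ^ 6 + |brownian t.toNNReal ω.2| ^ 6) +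
        32768 * t₀ ^ 5 * (Real.sqrt (2 * (pinnedChain ω₂ lam β γ).γ * T)) ^ 6 *
          (∫ u in (0:ℝ)..t, (|brownian u.toNNReal ω.1| ^ 6 + |brownian u.toNNReal ω.2| ^ 6)) +
        1048576 * γ ^ 6 * t₀ ^ 5 * (1 + t₀ ^ 6) * ∫ v in (0:ℝ)..t, (((pinnedChain ω₂ lam β γ).chainFlow N x
            (chainNoise N (Real.sqrt (2 * (pinnedChain ω₂ lam β γ).γ * T))
              (Real.sqrt (2 * (pinnedChain ω₂ lam β γ).γ * T)) (pairPath ω)) v).2 ⟨0, hN⟩ ^ 6 +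
          ((pinnedChain ω₂ lam β γ).chainFlow N x
            (chainNoise N (Real.sqrt (2 * (pinnedChain ω₂ lam β γ).γ * T))
              (Real.sqrt (2 * (pinnedChain ω₂ lam β γ).γ * T)) (pairPath ω)) v).2 ⟨N - 1, by omega⟩ ^ 6) := by
  set P := pinnedChain ω₂ lam β γ with hP
  set c := Real.sqrt (2 * P.γ * T) with hc
  set η := chainNoise N c c (pairPath ω) with hη
  set z : ℝ → PhaseSpace N := P.chainFlow N x η with hz
  have hzc : ∀ i, Continuous fun v => (z v).2 i := fun i => continuous_momentum_openChain hω hl hβ hγ T x ω i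
  set i₀ : Fin N := ⟨0, hN⟩
  set i₁ : Fin N := ⟨N - 1, by omega⟩
  set F : ℝ → ℝ := fun u => ∑ i : Fin N, |η u i - γ * ∫ v in (0:ℝ)..u, bathWeight N i * (z v).2 i| with hF
  have hFc : Continuous F := continuous_forcing hω hl hβ hγ T x ω
  set K : ℝ := ∫ v in (0:ℝ)..t, ((z v).2 i₀ ^ 6 + (z v).2 i₁ ^ 6) with hK
  set b : ℝ → ℝ := fun u => |brownian u.toNNReal ω.1| ^ 6 + |brownian u.toNNReal ω.2| ^ 6 with hb
  have hbc : Continuous b := by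
    have h1 : Continuous fun u : ℝ => brownian u.toNNReal ω.1 :=
      (continuous_brownian ω.1).comp continuous_real_toNNReal
    have h2 : Continuous fun u : ℝ => brownian u.toNNReal ω.2 :=
      (continuous_brownian ω.2).comp continuous_real_toNNReal
    exact (h1.abs.pow 6).add (h2.abs.pow 6)
  have ht0 : 0 ≤ t₀ := ht.le.trans htt
  have hK0 : 0 ≤ K := intervalIntegral.integral_nonneg ht.le fun v _ => by positivity
  -- pointwise bound on `F(u)⁶` for `u ∈ [0, t]`
  have hFu : ∀ u ∈ Icc (0:ℝ) t, F u ^ 6 ≤ 1024 * (c ^ 6 * b u + 32 * γ ^ 6 * t₀ ^ 5 * K) := by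
    intro u hu
    have h := forcing_pow_six_le hω hl hβ hγ hN T x ω hu.1 hu.2 htt
    simp only [hb]
    refine h.trans (le_of_eq ?_)
    ring
  -- the two terms
  have h1 : F t ^ 6 ≤ 1024 * (c ^ 6 * b t + 32 * γ ^ 6 * t₀ ^ 5 * K) := hFu t ⟨ht.le, le_rfl⟩
  have h2 : (∫ u in (0:ℝ)..t, F u) ^ 6 ≤ t₀ ^ 5 * (1024 * (c ^ 6 * ∫ u in (0:ℝ)..t, b u) +
      1024 * (32 * γ ^ 6 * t₀ ^ 5 * K) * t₀) := by
    have hJ := intervalIntegral_pow_six_le hFc ht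
    have hmono : ∫ u in (0:ℝ)..t, F u ^ 6 ≤ ∫ u in (0:ℝ)..t, 1024 * (c ^ 6 * b u + 32 * γ ^ 6 * t₀ ^ 5 * K) :=
      intervalIntegral.integral_mono_on ht.le ((hFc.pow 6).intervalIntegrable _ _)
        ((continuous_const.mul ((continuous_const.mul hbc).add continuous_const)).intervalIntegrable _ _) hFu
    have hi1 : IntervalIntegrable (fun u => c ^ 6 * b u) volume 0 t := (continuous_const.mul hbc).intervalIntegrable _ _
    have hi2 : IntervalIntegrable (fun _ : ℝ => 32 * γ ^ 6 * t₀ ^ 5 * K) volume 0 t :=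
      continuous_const.intervalIntegrable _ _
    have hadd := intervalIntegral.integral_add hi1 hi2
    have heval : ∫ u in (0:ℝ)..t, 1024 * (c ^ 6 * b u + 32 * γ ^ 6 * t₀ ^ 5 * K) =
        1024 * (c ^ 6 * ∫ u in (0:ℝ)..t, b u) + 1024 * (32 * γ ^ 6 * t₀ ^ 5 * K) * t := by
      rw [intervalIntegral.integral_const_mul, hadd, intervalIntegral.integral_const_mul,
        intervalIntegral.integral_const]
      simp only [sub_zero, smul_eq_mul]
      ring
    have hb0 : 0 ≤ ∫ u in (0:ℝ)..t, b u := intervalIntegral.integral_nonneg ht.le fun u _ => by positivity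
    have ht5 : t ^ 5 ≤ t₀ ^ 5 := pow_le_pow_left₀ ht.le htt 5
    have hI0 : 0 ≤ ∫ u in (0:ℝ)..t, F u ^ 6 := intervalIntegral.integral_nonneg ht.le fun u _ => by positivity
    calc (∫ u in (0:ℝ)..t, F u) ^ 6 ≤ t ^ 5 * ∫ u in (0:ℝ)..t, F u ^ 6 := hJ
      _ ≤ t₀ ^ 5 * (1024 * (c ^ 6 * ∫ u in (0:ℝ)..t, b u) + 1024 * (32 * γ ^ 6 * t₀ ^ 5 * K) * t) := by
          rw [← heval]; exact mul_le_mul ht5 hmono hI0 (by positivity)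
      _ ≤ t₀ ^ 5 * (1024 * (c ^ 6 * ∫ u in (0:ℝ)..t, b u) + 1024 * (32 * γ ^ 6 * t₀ ^ 5 * K) * t₀) := by
          have hY : 0 ≤ 1024 * (32 * γ ^ 6 * t₀ ^ 5 * K) :=
            mul_nonneg (by norm_num) (mul_nonneg (mul_nonneg (by positivity) (pow_nonneg ht0 5)) hK0)
          have hkey := mul_nonneg (mul_nonneg (pow_nonneg ht0 5) hY) (sub_nonneg.2 htt)
          nlinarith [hkey]
  have hsq := add_pow_six_le (F t) (∫ u in (0:ℝ)..t, F u)
  have hb0 : 0 ≤ ∫ u in (0:ℝ)..t, b u := intervalIntegral.integral_nonneg ht.le fun u _ => by positivity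
  have hc0 : 0 ≤ c ^ 6 := by positivity
  calc (F t + ∫ u in (0:ℝ)..t, F u) ^ 6 ≤ 32 * (F t ^ 6 + (∫ u in (0:ℝ)..t, F u) ^ 6) := hsq
    _ ≤ 32 * (1024 * (c ^ 6 * b t + 32 * γ ^ 6 * t₀ ^ 5 * K) +
        t₀ ^ 5 * (1024 * (c ^ 6 * ∫ u in (0:ℝ)..t, b u) + 1024 * (32 * γ ^ 6 * t₀ ^ 5 * K) * t₀)) := by
        nlinarith [h1, h2]
    _ = 32768 * c ^ 6 * b t + 32768 * t₀ ^ 5 * c ^ 6 * (∫ u in (0:ℝ)..t, b u) +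
        1048576 * γ ^ 6 * t₀ ^ 5 * (1 + t₀ ^ 6) * K := by ring

end Forcing

end Summit.AtomisticToContinuum.FouriersLaw.Theorems.ChainVariation

end
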